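/-
Copyright (c) 2026 the pub-hodgecm-mathlib formalisation cell (harness21).  R90-TF SLAB, section S10 (Rogawski 1990, Ch. 13.8), prover R90-C138-p01 (g0):
card W1-H3 = PAYER-TABLE-D2 row D1 (the frozen-family maps `ΦGu`); h413 = `stmt-HodgeConjecture-24833`, route `HCCMUnconditional`.
-/
import Summits.HodgeConjecture.HodgeConjecture.Theorems.R90S10FrozenDatumDefs          -- ★ C2 p862346: `S10HDatum`, `S10Frozen` (`fGi`, `hsmG`, `K`, `hKstd`, `ΦG`, `hΦG`), carriers `G3`, `GArch`
import Summits.HodgeConjecture.HodgeConjecture.Theorems.K2E1GlobalTestFunctionsBridge   -- ★ `GlobalTestFunction`, `toAdelic(_apply)`, `mulSupport_fin_locComp_finite`, ★ `locComp_eq_toLocal`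
import Literature.NumberTheory.Automorphic.HeckeAlgebraProofs                            -- ★ `heckeAlgebraToBiInvariant` (Frobenius reciprocity `ℋ(G, K) ≃ C_c(K\G/K)`)
import HarnessLib

/-!
# R90-TF ∕ S10 — THE FROZEN-FAMILY MAPS `ΦGu : (u, φ) ↦ f_∞ ⊗ φ ⊗ 𝟙_{K_{S∖v}} ⊗ u` AS ★ `GlobalTestFunction`s (PAYER-TABLE-D2 row D1; card W1-H3)

Cell hodgecm-mathlib, slab R90-TF, section S10 = [Rogawski1990] §13.8, crux item h413 = `stmt-HodgeConjecture-24833`; DEFINITIONS + proved read-backs (lane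
`--kind definition --supports stmt-HodgeConjecture-24833 --as helper`); no instance, no notation, no named fact, no `sorry`; LAW L9 (no `Cruxes/…/Lines` import:
F's `UnrSub S` ∕ `HeckeAt` are SPELLED by their bodies, reducibly — `UnrQs` ∕ `HeckeQs` below unfold to the same terms, `qsForm L ≡ splitForm L 3`).

THE OBJECT (print [Rogawski1990, §13.8 p. 218 L24 «`f = f_u × f_{v′} × f^{u,v′}`», §13.6 p. 209 «`f ∈ ⊗_{v∉S} 𝓗_v` (restricted direct product)»).  For the frozen
vectors `𝔳 : S10Frozen … 𝔥` at the place `v` (★ C2), a level `S` and an unramified pure tensor `u = ⊗_{w ∉ S} u_w`, `u_w ∈ 𝓗_w = 𝓗(U(Φ₃)(L⁺_w), U(Φ₃)(𝒪_w))`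
(★ `heckeAlgebra`), the member of the frozen family at `(u, φ)` is the PURE TENSOR `f_∞ ⊗ φ ⊗ (⊗_{w ∈ S, w ≠ v} 𝟙_{K_w}) ⊗ u` — typed here as a ★ `GlobalTestFunction L 3 (qsForm L)`
(K2E1 row 10: archimedean component + finite components, almost all the unit), so that ★ `toAdelic` realises it in `C_c(U(Φ₃)(𝔸_{L⁺}), ℂ)` and FILE D's heads
(`StableVanishingHyp`, `ThetaGPinnedHyp`, `DiscreteGermExpansionHyp`, binder `ΦGu : Unr → (Gqs L v → ℂ) → TG`) can be PINNED at `TG := GlobalTestFunction L 3 (qsForm L)`,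
`Unr := UnrQs L S` (= F's `UnrSub S`), `toCc := toAdelic`, and p07's unit test `e := unrUnit L S`.

CONTENTS.
* §1 (generic, ★ `HeckeAlgebra` currency) `coe_heckeAlgebraToBiInvariant_one` (`1 ↦ 𝟙_K`) and `isLocSmooth_heckeAlgebraToBiInvariant` (for `K` compact open the bi-`K`-invariant
  function of a Hecke element is locally constant with compact support).
* §2 `HeckeQs L w`, `UnrQs L S` (reducible spellings of F's `HeckeAt`, `UnrSub`), the unit `unrUnit`, `heckeBiInvFun` (a Hecke element as a function on `U(Φ₃)(L⁺_w)`),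
  `unrFin S u w` (the finite component at `w ≠ v`: `𝟙_{U(Φ₃)(𝒪_w)}` on `S`, the function of `u_w` off `S`), `locSmoothPart φ` (the total-in-`φ` junk guard).
* §3 **`S10Frozen.ΦGu 𝔳 S u φ : GlobalTestFunction L 3 (qsForm L)`** with the component read-backs `ΦGu_arch`, `ΦGu_fin_self`, `ΦGu_fin_of_ne`, `ΦGu_fin_unrUnit_of_ne`, and the PIN
  **`S10Frozen.toAdelic_ΦGu_unrUnit : IsLocSmooth φ → toAdelic (𝔳.ΦGu S (unrUnit L S) φ) = 𝔳.ΦG φ`** (at the unit the family member IS the datum's frozen function, ★ `hΦG`).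
NOT HERE (census (Q2), J-D5-1): the `H`-side map `ΦHu` — ★ `S10Frozen` records for `f^H_{∞,θ} = fHi₂` only the integral pin `hfHi₂` (no continuity ∕ compact support ∕
`ArchSmooth`), and the unramified slot needs the Hecke base-change maps `b_w` as data; it stays a PARAMETER of D ED. 3 (default (c)).

HONEST LABEL: definitions + read-backs; pays no socket until D's edition pins `ΦGu` to it; HC_CM is proved only modulo the 7 printed citations (2 remaining named inputs:
hLiu418 = `stmt-HodgeConjecture-24832`, h413 = `stmt-HodgeConjecture-24833`) until rung 0 closes; REL ≠ ★ ≠ BUILT.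

## References
* [Rogawski1990] J. Rogawski, *Automorphic Representations of Unitary Groups in Three Variables*, Ann. of Math. Stud. 123 (1990), §13.6 p. 209, §13.8 pp. 218–219, §4.5 p. 47.
* [BorelJacquet1979] A. Borel, H. Jacquet, *Automorphic forms and automorphic representations*, Corvallis (1979), §4.1.
* [Cartier1979] P. Cartier, *Representations of p-adic groups: a survey*, Corvallis (1979), §I.3–I.4.
-/

set_option autoImplicit false
set_option linter.dupNamespace false

noncomputable section

open scoped RestrictedProduct
open Filter MeasureTheory NumberField IsDedekindDomain CompactlySupported Topology
open Literature.NumberTheory.Rogawski1990 Literature.NumberTheory.Automorphic Literature.NumberTheory.Automorphic.UnitaryGroup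
open Literature.NumberTheory.GaloisRepresentations (HeckeCharacter)
open Summit.HodgeConjecture.HodgeConjecture.Cruxes.H413.K2E1TraceFormulaBeta
open Summit.HodgeConjecture.HodgeConjecture.Cruxes.H413.K2E1GlobalTestFunctions

namespace Summit.HodgeConjecture.HodgeConjecture.R90.S10

/-! ## §1 Hecke elements as locally smooth functions (generic) -/

section Hecke

variable {k G : Type*} [CommRing k] [Group G] (K : Subgroup G)

/-- **The unit of `ℋ(G, K)` is the unit double coset**: under Frobenius reciprocity ★ `heckeAlgebraToBiInvariant` (`T ↦ (g ↦` coefficient of `[gK]` in `T [K])`), `1 ↦ 𝟙_K`.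
[cite: Cartier1979, §I.3–I.4] -/
theorem coe_heckeAlgebraToBiInvariant_one :
    ((heckeAlgebraToBiInvariant k G K 1 : biInvariantFunctions k G K) : G → k) = (K : Set G).indicator 1 := by
  classical
  funext g
  rw [heckeAlgebraToBiInvariant_apply, OneMemClass.coe_one, Module.End.one_apply, MonoidAlgebra.coeff_single, Finsupp.single_apply]
  by_cases hg : g ∈ K
  · rw [Set.indicator_of_mem (SetLike.mem_coe.2 hg), Pi.one_apply, if_pos]
    exact (QuotientGroup.eq.2 (by rwa [inv_one, one_mul])).symm.symm
  · rw [Set.indicator_of_notMem (fun h => hg (SetLike.mem_coe.1 h)), if_neg]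
    intro h
    exact hg (by simpa only [inv_one, one_mul] using QuotientGroup.eq.1 h)

variable [TopologicalSpace G] [IsTopologicalGroup G]

/-- **For `K` compact open, the bi-`K`-invariant function of a Hecke element is LOCALLY SMOOTH** (★ `IsLocSmooth`: locally constant — it is right-`K`-invariant and `gK` is an
open neighbourhood of `g` — with compact support — its support meets finitely many double cosets `KgK = K·g·K`, each compact). «`𝓗(G, K) = C_c^∞(K\G/K)`».
[cite: Cartier1979, §I.3–I.4] [cite: Rogawski1990, §4.5 p. 47] -/
theorem isLocSmooth_heckeAlgebraToBiInvariant (hKo : IsOpen (K : Set G)) (hKc : IsCompact (K : Set G)) (T : heckeAlgebra ℂ G K) :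
    IsLocSmooth ((heckeAlgebraToBiInvariant ℂ G K T : biInvariantFunctions ℂ G K) : G → ℂ) := by
  obtain ⟨hinv, hfin⟩ := (mem_biInvariantFunctions_iff _).1 (heckeAlgebraToBiInvariant ℂ G K T).2
  refine ⟨(IsLocallyConstant.iff_eventually_eq _).2 fun x => ?_, ?_⟩
  · -- constant on the open neighbourhood `xK` of `x`
    have hU : {y : G | x⁻¹ * y ∈ (K : Set G)} ∈ 𝓝 x := by
      refine (hKo.preimage (continuous_const.mul continuous_id)).mem_nhds ?_
      show x⁻¹ * x ∈ (K : Set G)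
      rw [inv_mul_cancel]
      exact K.one_mem
    filter_upwards [hU] with y hy
    have h := hinv 1 K.one_mem (x⁻¹ * y) hy x
    rwa [one_mul, mul_inv_cancel_left] at h
  · -- supported in finitely many compact double cosets
    refine HasCompactSupport.intro (K := ⋃ q ∈ hfin.toFinset, DoubleCoset.doubleCoset q.out (K : Set G) K)
      (hfin.toFinset.isCompact_biUnion fun q _ => (hKc.mul isCompact_singleton).mul hKc) fun x hx => ?_
    by_contra hfx
    refine hx (Set.mem_iUnion₂.2 ⟨DoubleCoset.mk K K x, hfin.mem_toFinset.2 ⟨x, hfx, rfl⟩, ?_⟩)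
    exact (DoubleCoset.mem_quotToDoubleCoset_iff _ x).2 rfl

end Hecke

/-! ## §2 The unramified currency at `U(Φ₃)` (F's `HeckeAt`, `UnrSub` spelled reducibly), the unit, and the finite components -/

section Unramified

variable (L : Type) [Field L] [NumberField L] [IsCMField L]

/-- **`𝓗_w = 𝓗(U(Φ₃)(L⁺_w), U(Φ₃)(𝒪_w))`** — the unramified Hecke algebra at the standard integral level (★ `heckeAlgebra`, ★ `cmLocalIntegralLevel`); reducibly the SAME term as
FILE F's `HeckeAt L w` (`splitForm L 3 ≡ qsForm L`). [cite: Rogawski1990, §13.6 p. 209; §4.5 p. 47] -/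
abbrev HeckeQs (w : Pl L) : Type :=
  heckeAlgebra ℂ (Gqs L w) (cmLocalIntegralLevel L 3 (qsForm L) w)

/-- **`⊗'_{w ∉ S} 𝓗_w`** — restricted pure tensors `u = ⊗_{w∉S} u_w`, `u_w = 1` for almost all `w` («`f ∈ ⊗_{v∉S} 𝓗_v` (restricted direct product)»); reducibly the SAME
term as FILE F's `UnrSub S`. [cite: Rogawski1990, §13.6 p. 209] -/
abbrev UnrQs (S : Set (Pl L)) : Type :=
  {f : ∀ i : {i : Pl L // i ∉ S}, HeckeQs L i.1 // {i | f i ≠ 1}.Finite}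

/-- **The unit `e = ⊗_{w ∉ S} 1_{𝓗_w}`** of the restricted tensor product (p07's distinguished test: at `e` the frozen family member is the frozen function itself).
[cite: Rogawski1990, §13.6 p. 209] -/
def unrUnit (S : Set (Pl L)) : UnrQs L S :=
  ⟨fun _ => 1, by simp only [ne_eq, not_true_eq_false, Set.setOf_false, Set.finite_empty]⟩

/-- Components of the unit: `(unrUnit L S).1 i = 1`. [cite: Rogawski1990, §13.6 p. 209] -/
@[simp] theorem unrUnit_apply (S : Set (Pl L)) (i : {i : Pl L // i ∉ S}) : (unrUnit L S).1 i = 1 := rfl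

/-- **A Hecke element as a function on `U(Φ₃)(L⁺_w)`**: the bi-`K_w`-invariant compactly supported function of `T ∈ 𝓗_w` (★ `heckeAlgebraToBiInvariant`, Frobenius
reciprocity). [cite: Cartier1979, §I.3–I.4] -/
def heckeBiInvFun (w : Pl L) (T : HeckeQs L w) : Gqs L w → ℂ :=
  ((heckeAlgebraToBiInvariant ℂ (Gqs L w) (cmLocalIntegralLevel L 3 (qsForm L) w) T :
      biInvariantFunctions ℂ (Gqs L w) (cmLocalIntegralLevel L 3 (qsForm L) w)) : Gqs L w → ℂ)

/-- `heckeBiInvFun w 1 = 𝟙_{U(Φ₃)(𝒪_w)}`. [cite: Cartier1979, §I.3–I.4] -/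
theorem heckeBiInvFun_one (w : Pl L) :
    heckeBiInvFun L w 1 = (cmLocalIntegralLevel L 3 (qsForm L) w : Set (Gqs L w)).indicator 1 :=
  coe_heckeAlgebraToBiInvariant_one _

/-- `heckeBiInvFun w T` is locally smooth (`U(Φ₃)(𝒪_w)` is compact open, ★ `isCompact_isOpen_cmLocalIntegralLevel`). [cite: Rogawski1990, §4.5 p. 47] -/
theorem isLocSmooth_heckeBiInvFun (w : Pl L) (T : HeckeQs L w) : IsLocSmooth (heckeBiInvFun L w T) :=
  isLocSmooth_heckeAlgebraToBiInvariant _ (isCompact_isOpen_cmLocalIntegralLevel L 3 (qsForm L) w).2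
    (isCompact_isOpen_cmLocalIntegralLevel L 3 (qsForm L) w).1 T

/-- **The finite component at a place `w` (off the distinguished `v`) of the family member at `u`**: the standard unit `𝟙_{U(Φ₃)(𝒪_w)}` at `w ∈ S`, the function of the
Hecke element `u_w` at `w ∉ S` («`f^{u,v′}` a unit of the Hecke algebra», p. 219 L2; «`f^S = ⊗ f_v`», p. 209). [cite: Rogawski1990, §13.8 p. 219 L2; §13.6 p. 209] -/
def unrFin (S : Set (Pl L)) (u : UnrQs L S) (w : Pl L) : Gqs L w → ℂ := by
  classical
  exact if hw : w ∈ S then (cmLocalIntegralLevel L 3 (qsForm L) w : Set (Gqs L w)).indicator 1 else heckeBiInvFun L w (u.1 ⟨w, hw⟩)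

/-- On `S`: `unrFin S u w = 𝟙_{U(Φ₃)(𝒪_w)}`. [cite: Rogawski1990, §13.8 p. 219 L2] -/
theorem unrFin_of_mem (S : Set (Pl L)) (u : UnrQs L S) {w : Pl L} (hw : w ∈ S) :
    unrFin L S u w = (cmLocalIntegralLevel L 3 (qsForm L) w : Set (Gqs L w)).indicator 1 := by
  unfold unrFin
  rw [dif_pos hw]

/-- Off `S`: `unrFin S u w` is the function of `u_w`. [cite: Rogawski1990, §13.6 p. 209] -/
theorem unrFin_of_not_mem (S : Set (Pl L)) (u : UnrQs L S) {w : Pl L} (hw : w ∉ S) :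
    unrFin L S u w = heckeBiInvFun L w (u.1 ⟨w, hw⟩) := by
  unfold unrFin
  rw [dif_neg hw]

/-- At the unit `e`: `unrFin S e w = 𝟙_{U(Φ₃)(𝒪_w)}` at EVERY `w`. [cite: Rogawski1990, §13.8 p. 219 L2] -/
theorem unrFin_unrUnit (S : Set (Pl L)) (w : Pl L) :
    unrFin L S (unrUnit L S) w = (cmLocalIntegralLevel L 3 (qsForm L) w : Set (Gqs L w)).indicator 1 := by
  by_cases hw : w ∈ S
  · exact unrFin_of_mem L S _ hw
  · rw [unrFin_of_not_mem L S _ hw, unrUnit_apply, heckeBiInvFun_one]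

/-- Every `unrFin S u w` is locally smooth. [cite: Rogawski1990, §4.5 p. 47] -/
theorem isLocSmooth_unrFin (S : Set (Pl L)) (u : UnrQs L S) (w : Pl L) : IsLocSmooth (unrFin L S u w) := by
  by_cases hw : w ∈ S
  · rw [unrFin_of_mem L S u hw]
    exact isLocSmooth_indicator_cmLocalIntegralLevel L 3 (qsForm L) w
  · rw [unrFin_of_not_mem L S u hw]
    exact isLocSmooth_heckeBiInvFun L w _

/-- `unrFin S u w` is the standard unit for all but finitely many `w` (those `w ∉ S` with `u_w ≠ 1`). [cite: Rogawski1990, §13.6 p. 209] -/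
theorem unrFin_eventually_eq_indicator (S : Set (Pl L)) (u : UnrQs L S) :
    ∀ᶠ w in cofinite, unrFin L S u w = (cmLocalIntegralLevel L 3 (qsForm L) w : Set (Gqs L w)).indicator 1 := by
  refine Filter.eventually_cofinite.2 ((u.2.image Subtype.val).subset fun w hw => ?_)
  by_cases hS : w ∈ S
  · exact absurd (unrFin_of_mem L S u hS) hw
  · refine ⟨⟨w, hS⟩, fun h1 => hw ?_, rfl⟩
    rw [unrFin_of_not_mem L S u hS, show u.1 ⟨w, hS⟩ = 1 from h1, heckeBiInvFun_one]

variable (v : Pl L)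

/-- **The junk guard at `v`**: `φ` itself when `φ` is locally smooth, `0` otherwise (FILE D's binder `ΦGu : Unr → (Gqs L v → ℂ) → TG` is total in `φ`; every consumer reads it
at locally smooth `φ`, where it is `φ`). [cite: Rogawski1990, §13.8 p. 218 L24] -/
def locSmoothPart (φ : Gqs L v → ℂ) : Gqs L v → ℂ := by
  classical
  exact if IsLocSmooth φ then φ else 0

/-- `locSmoothPart φ = φ` for locally smooth `φ`. [cite: Rogawski1990, §13.8 p. 218 L24] -/
theorem locSmoothPart_of_isLocSmooth {φ : Gqs L v → ℂ} (hφ : IsLocSmooth φ) : locSmoothPart L v φ = φ := by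
  unfold locSmoothPart
  rw [if_pos hφ]

/-- `locSmoothPart φ` is locally smooth. [cite: Rogawski1990, §1.6 p. 6] -/
theorem isLocSmooth_locSmoothPart (φ : Gqs L v → ℂ) : IsLocSmooth (locSmoothPart L v φ) := by
  unfold locSmoothPart
  split_ifs with h
  · exact h
  · exact isLocSmooth_zero

end Unramified

/-! ## §3 The frozen-family map `ΦGu` and its pin at the unit -/

section Family

variable {L : Type} [Field L] [NumberField L] [IsCMField L] [DecidableEq (Pl L)] {μ : HeckeCharacter L} {v : Pl L}
  [MeasurableSpace (HLoc L v)] [BorelSpace (HLoc L v)] [MeasurableSpace (Gqs L v)] [BorelSpace (Gqs L v)]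
  {νHv : Measure (HLoc L v)} {νQv : Measure (Gqs L v)} [νHv.IsHaarMeasure] [νHv.IsMulRightInvariant] [νQv.IsHaarMeasure] [νQv.IsMulRightInvariant]
  [∀ a : HLoc L v, MeasurableSpace (HLoc L v ⧸ Subgroup.centralizer ({a} : Set (HLoc L v)))]
  [∀ a : HLoc L v, BorelSpace (HLoc L v ⧸ Subgroup.centralizer ({a} : Set (HLoc L v)))]
  [∀ γ : Gqs L v, MeasurableSpace (Gqs L v ⧸ Subgroup.centralizer ({γ} : Set (Gqs L v)))]
  [∀ γ : Gqs L v, BorelSpace (Gqs L v ⧸ Subgroup.centralizer ({γ} : Set (Gqs L v)))]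
  {mHv : OrbitalMeasureFamily (HLoc L v)} {mQv : OrbitalMeasureFamily (Gqs L v)} {πSt : IrrClass (HLoc L v)}
  [MeasurableSpace (H2 L).Adelic] [BorelSpace (H2 L).Adelic]
  [MeasurableSpace (GArch L)] [BorelSpace (GArch L)] [MeasurableSpace (HArch L)] [BorelSpace (HArch L)]
  [MeasurableSpace (H1Loc L v)] [MeasurableSpace (H1Arch L)] [MeasurableSpace (H1 L).Adelic] [BorelSpace (H1 L).Adelic]
  {𝔥 : S10HDatum L μ v νHv νQv mHv mQv πSt}

/-- **THE FROZEN-FAMILY MAP `ΦGu`**: for the frozen vectors `𝔳` at `v`, a level `S` and `(u, φ)`, the GLOBAL TEST FUNCTION `f_∞ ⊗ φ ⊗ 𝟙_{K_{S∖v}} ⊗ u` on `U(Φ₃)(𝔸_{L⁺})`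
(★ `GlobalTestFunction L 3 (qsForm L)`): archimedean component `f_∞ = 𝔳.fGi` (smooth by `𝔳.hsmG` — ★ `ArchSmooth` is the field's clause token for token), component `φ` at `v` (through
the junk guard `locSmoothPart`), `𝟙_{U(Φ₃)(𝒪_w)}` at `w ∈ S ∖ {v}` (= `𝟙_{𝔳.K w}`, ★ `S10Frozen.hKstd`), the function of `u_w` at `w ∉ S`.  «`f = f_u × f_{v′} × f^{u,v′}`».
[cite: Rogawski1990, §13.8 p. 218 L24, p. 219 L2; §13.6 p. 209] [cite: BorelJacquet1979, §4.1] -/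
def S10Frozen.ΦGu (𝔳 : S10Frozen L μ v νHv νQv mHv mQv πSt 𝔥) (S : Set (Pl L)) (u : UnrQs L S) (φ : Gqs L v → ℂ) :
    GlobalTestFunction L 3 (qsForm L) where
  arch := ⇑𝔳.fGi
  continuous_arch := 𝔳.fGi.continuous
  hasCompactSupport_arch := 𝔳.fGi.hasCompactSupport
  isArchSmooth_arch := 𝔳.hsmG
  fin := Function.update (unrFin L S u) v (locSmoothPart L v φ)
  isLocSmooth_fin w := by
    by_cases hw : w = v
    · subst hw
      rw [Function.update_self]
      exact isLocSmooth_locSmoothPart L _ φ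
    · rw [Function.update_of_ne hw]
      exact isLocSmooth_unrFin L S u w
  fin_eventually_eq_indicator := by
    have hv : ∀ᶠ w in cofinite, w ≠ v := (Set.finite_singleton v).compl_mem_cofinite
    filter_upwards [hv, unrFin_eventually_eq_indicator L S u] with w hw hu
    rw [Function.update_of_ne hw, hu]

/-- READ-BACK: the archimedean component of every family member is `f_∞ = 𝔳.fGi`. [cite: Rogawski1990, §13.8 p. 218 L20–L24] -/
@[simp] theorem S10Frozen.ΦGu_arch (𝔳 : S10Frozen L μ v νHv νQv mHv mQv πSt 𝔥) (S : Set (Pl L)) (u : UnrQs L S) (φ : Gqs L v → ℂ) :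
    (𝔳.ΦGu S u φ).arch = ⇑𝔳.fGi := rfl

/-- READ-BACK: the component at `v` is `φ` (for locally smooth `φ`). [cite: Rogawski1990, §13.8 p. 218 L24] -/
theorem S10Frozen.ΦGu_fin_self (𝔳 : S10Frozen L μ v νHv νQv mHv mQv πSt 𝔥) (S : Set (Pl L)) (u : UnrQs L S) {φ : Gqs L v → ℂ} (hφ : IsLocSmooth φ) :
    (𝔳.ΦGu S u φ).fin v = φ := by
  show Function.update (unrFin L S u) v (locSmoothPart L v φ) v = φ
  rw [Function.update_self, locSmoothPart_of_isLocSmooth L v hφ]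

/-- READ-BACK: the component at `w ≠ v` is `unrFin S u w` (`𝟙_{U(Φ₃)(𝒪_w)}` on `S`, the function of `u_w` off `S`). [cite: Rogawski1990, §13.8 p. 219 L2; §13.6 p. 209] -/
theorem S10Frozen.ΦGu_fin_of_ne (𝔳 : S10Frozen L μ v νHv νQv mHv mQv πSt 𝔥) (S : Set (Pl L)) (u : UnrQs L S) (φ : Gqs L v → ℂ) {w : Pl L} (hw : w ≠ v) :
    (𝔳.ΦGu S u φ).fin w = unrFin L S u w := by
  show Function.update (unrFin L S u) v (locSmoothPart L v φ) w = unrFin L S u w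
  rw [Function.update_of_ne hw]

/-- READ-BACK AT THE UNIT: at `u = e` every component off `v` is `𝟙_{U(Φ₃)(𝒪_w)} = 𝟙_{𝔳.K w}` (★ `S10Frozen.hKstd`). [cite: Rogawski1990, §13.8 p. 218 L24, p. 219 L2] -/
theorem S10Frozen.ΦGu_fin_unrUnit_of_ne (𝔳 : S10Frozen L μ v νHv νQv mHv mQv πSt 𝔥) (S : Set (Pl L)) (φ : Gqs L v → ℂ) {w : Pl L} (hw : w ≠ v) :
    (𝔳.ΦGu S (unrUnit L S) φ).fin w = (𝔳.K w : Set (Gqs L w)).indicator 1 := by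
  rw [S10Frozen.ΦGu_fin_of_ne 𝔳 S _ φ hw, unrFin_unrUnit, ← 𝔳.hKstd w hw]

/-- Splitting one factor off a finite product: `∏ᶠ i, f i = f a · ∏ᶠ_{i ≠ a} f i`. [folklore] -/
private theorem finprod_eq_mul_finprod_cond_ne {ι M : Type*} [CommMonoid M] [DecidableEq ι] (f : ι → M)
    (hf : (Function.mulSupport f).Finite) (a : ι) : ∏ᶠ i, f i = f a * ∏ᶠ (i) (_ : i ≠ a), f i := by
  rw [finprod_cond_ne f a hf, finprod_eq_prod_of_mulSupport_toFinset_subset f hf (Finset.subset_insert a hf.toFinset),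
    ← Finset.mul_prod_erase (insert a hf.toFinset) f (Finset.mem_insert_self a _), Finset.erase_insert_eq_erase]

/-- **THE PIN AT THE UNIT — `toAdelic (ΦGu 𝔳 S e φ) = 𝔳.ΦG φ` for locally smooth `φ`**: the family member at the unit test `e` IS the datum's frozen function
`f = f_∞ ⊗ φ ⊗ 𝟙_{K^v}` (★ `S10Frozen.hΦG`, read through ★ `toAdelic_apply` and ★ `locComp_eq_toLocal`) — the junction p07's W1-H1 (`cD` at `e`) and row 6 (`hd4`) consume.
[cite: Rogawski1990, §13.8 p. 218 L24, p. 219 L2] [cite: BorelJacquet1979, §4.1] -/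
theorem S10Frozen.toAdelic_ΦGu_unrUnit (𝔳 : S10Frozen L μ v νHv νQv mHv mQv πSt 𝔥) (S : Set (Pl L)) {φ : Gqs L v → ℂ} (hφ : IsLocSmooth φ) :
    toAdelic (𝔳.ΦGu S (unrUnit L S) φ) = 𝔳.ΦG φ := by
  ext g
  refine Eq.trans ?_ (𝔳.hΦG φ hφ g).symm
  rw [toAdelic_apply, S10Frozen.ΦGu_arch]
  congr 1
  -- the finite part: split off the factor at `v`, read the components
  rw [finprod_eq_mul_finprod_cond_ne _ (mulSupport_fin_locComp_finite _ g) v, ← finprod_subtype_eq_finprod_cond (fun w => w ≠ v),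
    locComp_eq_toLocal, S10Frozen.ΦGu_fin_self 𝔳 S _ hφ]
  congr 1
  refine finprod_congr fun w => ?_
  rw [locComp_eq_toLocal, S10Frozen.ΦGu_fin_unrUnit_of_ne 𝔳 S φ w.2]
  rfl

end Family

end Summit.HodgeConjecture.HodgeConjecture.R90.S10

end
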